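import Mathlib.Tactic

/-!
# D-0122 AXIS B, knob k2 (LABEL SET) — a TRUNCATED label set `{1,…,L}` with `2 ≤ L ≤ l⋆ − 1` is closed under the multiplication of labels
# (`𝔽_l^⋇ = 𝔽_l^×/{±1}`, label of a residue `y` = `min(y, l − y)`) for NO modulus `l`; for prime `l` the full set `{1,…,l⋆}` is closed, so
# «`{1,…,L}` multiplicatively closed ⟺ L = 1 ∨ L = l⋆» — the kernel face of the k2 NEW-THEORY clause of the D-0121 FINAL Part (II)

abc-iut cell, rung LADDER-ABC:A2.RESCUE.H; seat abc-iut-reqb-typ-2 (typer k2/k3/k5; companion of `RHReqsideLabelsInd` p505937 §1 «k2 LABEL SET `{1,…,L}`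
decoupled from `l`», whose CONSISTENCY paragraph recorded the question «a proper subset `{1,…,L}` is not symmetry-stable»); the statement and its one-line
witness are abc-iut-reqb-rf-2's (GEN 2, row PAIRSCONS (B), `NEWTHEORY-K2K3-rf-2.md` v2/v3 clause (c); scratch `TruncatedLabelsNoSymmetry.lean` 4bc985a8e370a252,
offered 2026-08-27T08:03:29Z «reqb-typ-2 may lift it verbatim»), adapted here PROOF-ONLY (0 definitions: the label map is written out as `min y (l − y)`),
with the prime-`l` converse and the resulting iff added. Owner abc-iut-rh-lead g3/g4; referee abc-iut-reqb-ref-1.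

THE ARITHMETIC. In [IUTchI] the evaluation labels are the nonzero elements of `𝔽_l` up to sign, `|𝔽_l^⋇| = l⋆ = (l−1)/2`, represented by `{1,…,l⋆}`, and the
`𝔽_l^{⋊±}` / `𝔽_l^⋇`-symmetries act through multiplication of residues; a label subset that is the orbit of the label `1` under a subgroup `H ≤ 𝔽_l^⋇` is `H`
itself, hence closed under the label product `(x, y) ↦ min(xy mod l, l − (xy mod l))`. REQB-SPEC's k2 truncation keeps `{1,…,L}` at fixed `l`.
* `truncatedLabels_two_mul_escapes`: for `2 ≤ L` and `2L + 3 ≤ l` (i.e. `L ≤ l⋆ − 1` when `l = 2l⋆ + 1`; NO primality needed) the labels `2` and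
  `x := ⌊L/2⌋ + 1` lie in `{1,…,L}` but `L < 2x ≤ L + 2 ≤ l − L − 1`, so the label of `2·x` is `> L`: an explicit escaping product.
* `truncatedLabels_closed_only_trivially`: hence a subset `S = {1,…,L}` of labels closed under the label product forces `L ≤ 1 ∨ l ≤ 2L + 2`.
* `fullLabels_mul_closed`: for PRIME `l ≠ 2` the full set `{1,…,(l−1)/2}` IS closed (a product of nonzero residues is nonzero mod a prime, and
  `min(r, l − r) ≤ (l−1)/2` for odd `l`); `singletonLabel_mul_closed`: so is `{1}`.
* `truncatedLabels_closed_iff`: for prime `l ≠ 2` and `1 ≤ L ≤ l⋆`: `{1,…,L}` is closed under the label product ⟺ `L = 1 ∨ L = l⋆`.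
READING (the rf seats' column, recorded not adjudicated): the k2.trunc rows of REQB-TABLE v1 (`L = ⌈l⋆/2⌉`, `⌈√l⋆⌉`) use a label set that is the orbit of
no subgroup of the symmetry — the sense in which abc-iut-reqb-rf-2 words them «symmetry-free» (CONSISTENCY = INCONSISTENT / NEW-THEORY in the table;
`RH.ReqsideTableV1.table`). Machine cross-check of record: rf-2's coset_check.py 3646c2d071d43249 (all odd primes `5 ≤ l ≤ 400`, 6 751 `(l, L)` pairs, 0 cosets).

HONEST FRAMING. Elementary arithmetic of residues modulo `l`; «label», «symmetry» are used in OUR typed currency (`RHLabelWeightSchemes`, `RHReqsideLabelsInd`);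
nothing here asserts that abc is proved or refuted, that [IUTchIII] Cor. 3.12 / [IUTchIV] Thm. 1.10 holds or fails, or takes a side on any author; a
parameter change of our functional is not a claim that [IUTchI–III] admit it; typed ≠ proved; located ≠ adjudicated. [claim: Mochizuki2012, status: disputed]
for the IUT locutions ([IUTchI] Prop. 4.9 (i), Rmk. 4.9.1 (ii): the `𝔽_l^⋇`-torsor of labels). [folklore] for every statement below.
-/

namespace Summit.ABC.IUTFork.Repair.RH.ReqsideLabelsNoSymmetry

/-- **A truncated label set is not closed under the label product — explicit witness** (abc-iut-reqb-rf-2): for `2 ≤ L` and `2L + 3 ≤ l` the label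
`x = ⌊L/2⌋ + 1 ∈ {1,…,L}` has `2·x mod l = 2x` (as `2x < l`), a NONZERO residue whose label `min(2x, l − 2x)` exceeds `L`, although `2 ∈ {1,…,L}`.
No primality hypothesis. [folklore] -/
theorem truncatedLabels_two_mul_escapes (l L : ℕ) (hL : 2 ≤ L) (hl : 2 * L + 3 ≤ l) :
    ∃ x, 1 ≤ x ∧ x ≤ L ∧ 0 < 2 * x % l ∧ L < min (2 * x % l) (l - 2 * x % l) := by
  refine ⟨L / 2 + 1, by omega, by omega, ?_, ?_⟩
  · have h : 2 * (L / 2 + 1) % l = 2 * (L / 2 + 1) := Nat.mod_eq_of_lt (by omega)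
    rw [h]; omega
  · have h : 2 * (L / 2 + 1) % l = 2 * (L / 2 + 1) := Nat.mod_eq_of_lt (by omega)
    rw [h]
    exact lt_min (by omega) (by omega)

/-- **Hence `{1,…,L}` closed under the label product `(x, y) ↦ min(xy mod l, l − (xy mod l))` forces `L ≤ 1` or `l ≤ 2L + 2`** (i.e. `L ∈ {0, 1, l⋆}` when
`l = 2l⋆ + 1` and `L ≤ l⋆`): the contrapositive of the witness, for an arbitrary set `S` of naturals that equals `{1,…,L}`. (abc-iut-reqb-rf-2's
`truncatedLabels_closed_only_trivially`, clause (c) of NEWTHEORY-K2K3-rf-2.) [folklore] -/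
theorem truncatedLabels_closed_only_trivially (l L : ℕ) (S : Set ℕ) (hsub : ∀ x, x ∈ S ↔ (1 ≤ x ∧ x ≤ L))
    (hmul : ∀ x y, x ∈ S → y ∈ S → min (x * y % l) (l - x * y % l) ∈ S) : L ≤ 1 ∨ l ≤ 2 * L + 2 := by
  by_contra h
  push Not at h
  obtain ⟨x, hx1, hxL, _, hlab⟩ := truncatedLabels_two_mul_escapes l L (by omega) (by omega)
  have h2 : 2 ∈ S := (hsub 2).2 ⟨by norm_num, by omega⟩
  have hx : x ∈ S := (hsub x).2 ⟨hx1, hxL⟩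
  have := ((hsub _).1 (hmul 2 x h2 hx)).2
  omega

/-- **For PRIME `l ≠ 2` the FULL label set `{1,…,(l−1)/2}` is closed under the label product**: if `1 ≤ x, y ≤ (l−1)/2` then `xy mod l ≠ 0` (a prime
divides a product only through a factor, and `0 < x, y < l`), so its label `min(r, l − r)`, `r = xy mod l ∈ [1, l−1]`, lies in `[1, (l−1)/2]` (`l` odd).
[folklore] -/
theorem fullLabels_mul_closed (l : ℕ) (hp : l.Prime) (h2 : l ≠ 2) (x y : ℕ) (hx : 1 ≤ x ∧ x ≤ (l - 1) / 2) (hy : 1 ≤ y ∧ y ≤ (l - 1) / 2) :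
    1 ≤ min (x * y % l) (l - x * y % l) ∧ min (x * y % l) (l - x * y % l) ≤ (l - 1) / 2 := by
  have hl2 : 2 ≤ l := hp.two_le
  have hodd : l % 2 = 1 := Nat.odd_iff.mp (hp.odd_of_ne_two h2)
  have hr : x * y % l < l := Nat.mod_lt _ (by omega)
  have hr0 : x * y % l ≠ 0 := by
    intro h0
    have hdvd : l ∣ x * y := Nat.dvd_of_mod_eq_zero h0
    rcases (Nat.Prime.dvd_mul hp).mp hdvd with hxd | hyd
    · exact absurd (Nat.le_of_dvd (by omega) hxd) (by omega)
    · exact absurd (Nat.le_of_dvd (by omega) hyd) (by omega)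
  constructor
  · exact le_min (by omega) (by omega)
  · rcases Nat.lt_or_ge ((l - 1) / 2) (x * y % l) with h | h
    · exact (min_le_right _ _).trans (by omega)
    · exact (min_le_left _ _).trans h

/-- **The singleton `{1}` is closed too** (`l ≥ 3`): `1·1 mod l = 1` and `min(1, l − 1) = 1`. [folklore] -/
theorem singletonLabel_mul_closed (l : ℕ) (hl : 3 ≤ l) : min (1 * 1 % l) (l - 1 * 1 % l) = 1 := by
  have h : 1 * 1 % l = 1 := by rw [one_mul]; exact Nat.mod_eq_of_lt (by omega)
  rw [h]
  exact min_eq_left (by omega)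

/-- **`truncatedLabels_closed_iff` — for prime `l ≠ 2` and `1 ≤ L ≤ l⋆ = (l−1)/2`: the label set `{1,…,L}` is closed under the label product
`(x, y) ↦ min(xy mod l, l − (xy mod l))` IF AND ONLY IF `L = 1 ∨ L = l⋆`.** So a k2 truncation `{1,…,L}` with `2 ≤ L ≤ l⋆ − 1` (REQB-TABLE v1 rows
`trunc:half`, `trunc:sqrt` at every tabulated `l`) is the orbit of NO subgroup of the label symmetry — the arithmetic behind abc-iut-reqb-rf-2's word
«symmetry-free»; located ≠ adjudicated. [folklore] -/
theorem truncatedLabels_closed_iff (l L : ℕ) (hp : l.Prime) (h2 : l ≠ 2) (hL1 : 1 ≤ L) (hLl : L ≤ (l - 1) / 2) :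
    (∀ x y, (1 ≤ x ∧ x ≤ L) → (1 ≤ y ∧ y ≤ L) → (1 ≤ min (x * y % l) (l - x * y % l) ∧ min (x * y % l) (l - x * y % l) ≤ L)) ↔
      (L = 1 ∨ L = (l - 1) / 2) := by
  have hl2 : 2 ≤ l := hp.two_le
  have hodd : l % 2 = 1 := Nat.odd_iff.mp (hp.odd_of_ne_two h2)
  constructor
  · intro hcl
    have key := truncatedLabels_closed_only_trivially l L {x | 1 ≤ x ∧ x ≤ L} (fun x => Iff.rfl)
      (fun x y hx hy => (hcl x y hx hy))
    rcases key with h | h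
    · left; omega
    · right; omega
  · rintro (rfl | rfl) x y hx hy
    · have hx1 : x = 1 := by omega
      have hy1 : y = 1 := by omega
      subst hx1; subst hy1
      rw [singletonLabel_mul_closed l (by omega)]
      exact ⟨le_rfl, le_rfl⟩
    · exact fullLabels_mul_closed l hp h2 x y hx hy

end Summit.ABC.IUTFork.Repair.RH.ReqsideLabelsNoSymmetry
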